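import Literature.MathematicalPhysics.QuantumFieldTheory.Balaban1983to89.B9Eq326DeltaABlockDecayTower
import Literature.MathematicalPhysics.QuantumFieldTheory.Balaban1983to89.B9Eq3126QG1QInvPointDecayTower
import Literature.MathematicalPhysics.QuantumFieldTheory.Balaban1983to89.B9Eq3126H1BlockDecayOfLettersTower

/-!
# `Balaban1983to89.B9Eq3126H1BlockDecayTower` — T. Bałaban, *Propagators for lattice gauge theories in a background field*, Commun. Math. Phys. **99** (1985)
# 389–434 [Balaban1985BackgroundPropagators] (3.15)∕(3.16) p. 393, (3.26) p. 395, (3.49) p. 399, (3.126) p. 420, Thm 3.11 p. 416 with [Balaban1985Variational] (45)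
# p. 285, (103) p. 293, (110) p. 294: **THE `L²` DECAY OF `H₁,k(U) = G₁,k(U)Q_k*(Q_kG₁,k(U)Q_k*)⁻¹` AT EVERY HEIGHT `n` — THE END OF ROAD ΔA-CT's `H₁` ROW ON THE
# TOWER: `‖P_{y₁} ∘ H₁,k(U) ∘ r_{y₀}‖ ≤ (4∕γ)e^{r}·C_Q†·(2∕μ₁)e^{r}·K_d(r − r′)²·e^{−r′·d_m(y₀,y₁)}`** for every bond-big-block family `P`, the coarse-bond point
# family `r`, every `0 ≤ r′ < r`, given — on the SAME displayed letters — the `G₁,k(U)` block-decay END `B9Eq326DeltaABlockDecayTower.norm_block_G1k_le` (v2;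
# `(4∕γ)e^{r}`), the `(Q_kG₁Q_k*)⁻¹` point-decay END `B9Eq3126QG1QInvPointDecayTower.norm_bondPoint_Kinv_le` (`(2∕μ₁)e^{r}`), the `Q_k†` block-to-point letter
# `C_Q†` (displayed), composed by `B9Eq3126H1BlockDecayOfLettersTower.norm_block_H1k_le_of_letters` — the TOWER PORT of `B9Eq3126H1BlockDecay`

statement-level skeleton of published theorems with citation tags; proofs where landed; nothing here is a claim about the Yang–Mills mass gap

CITATION HEADER (lean-in-tree rule).  Audit cell `pub-balaban`, sub-cell `t4`, BINDER row NE9 (road ΔA-CT of the NE9 formalisation swarm, leaf prover 03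
`b2b-balaban-t4-ne9-formalise-leaf-03` gen 76).  Imports this lineage's `B9Eq326DeltaABlockDecayTower` (v2), `B9Eq3126QG1QInvPointDecayTower`,
`B9Eq3126H1BlockDecayOfLettersTower`.  Sources READ first-hand: [Balaban1985BackgroundPropagators] p. 399 (3.49) (print's `δ₀` NOT asserted: the rate is the radius
`r` the displayed windows allow, minus the composition loss), p. 393 (3.15)∕(3.16), p. 395 (3.26), p. 416 Thm 3.11, p. 420 (3.126); [Balaban1985Variational] p. 285
(45), p. 293 (103), p. 294 (110).

WHAT IS PROVED (sorry-free; proof lane — no `def`; [folklore] composition BY NAME).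
* **`norm_block_H1k_le`** — the END above at every height `n`, one term: `norm_block_H1k_le_of_letters` at `hG := norm_block_G1k_le`, `hK := norm_bondPoint_Kinv_le`
  (both on the SAME `hQK`), `hQa` displayed; «`Q_k` onto» displayed as `hQs` for `(Q_kG₁Q_k*)⁻¹` and discharged inside `H1k` by `QkW_surjective … hαL`.
HONEST SCOPE.  Composition; every analytic letter DISPLAYED per height (`γ`, `μ₁`, `p_K`, `β_K`, `C_Q`, the conjugated `Q_k(U)` letters — supplier t4-ne9-p1's
`B9Eq349ConjugatedQTowerLetters` — `ρ`, `C_P`, `C_Q†`, the windows); NO `∃` before the height (the level-free suppliers close it); the rate loss and `K_d(r − r′)²`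
are the algebra's price; no number; CELL-ONLY by the refuter desk's §1, agreed; NOT NE9 (cell pub-balaban: NE9 NOT PRINTED ∕ NOT PROVED; «NE9 ⇐ the named
binders»; row WALLED ON A MODEL (O-NE9-1; #5 UNRULED); spine PROVED 0∕9; rung (B)+1 on a finite T⁴ — NOT infinite volume, NOT mass gap, NOT BetaPertH, NOT Clay;
HONEST DEPENDENCY: continuum YM on T⁴ ⇐ BetaPertH ∧ nine spine estimates (0/9 proved); BetaPertH ⇐ (D1) ∧ (D4) ∧ CAP+tail).  NEW file; nothing modified.
Net new unproved facts: 0.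
-/

noncomputable section

open scoped InnerProductSpace ComplexConjugate
open NormedSpace

namespace Literature.MathematicalPhysics.QuantumFieldTheory.Balaban1983to89.B9Eq3126H1BlockDecayTower

open B4Sect5Torus (TSite tdist)
open B4Sect5Proof (latticeConst)
open B9SectCLatticeCarrier (Bond bpos btgt)
open B9Eq311L2Pairing (WL2)
open B9Eq319QprimeTorus (fineP blockCoord)
open B9Eq315QTower (towerP)
open B9Eq315QTorus (perCfg cornerSite)
open B7Prop1Explicit (Wcx boxVec U1)
open B9Eq316TowerFlatIsOneStep (siteCast towerP_eq_fineP_pow)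
open B11Eq103H1Complex (SiteL2K BondL2K covDivL2K KinvLatticeK)
open B9Eq310HessianOperator (adTransportW PlaqL2K curvOp)
open B9Eq326OperatorTower (laplaceAk RofUk G1k H1k QkW)
open B9Eq326DeltaABlockDecayTower (norm_block_G1k_le)
open B9Eq3126QG1QInvPointDecayTower (norm_bondPoint_Kinv_le)
open B9Eq3126H1BlockDecayOfLettersTower (norm_block_H1k_le_of_letters)

variable {d : ℕ} {L : ℕ} [NeZero L] {m : Fin d → ℕ} [∀ i, NeZero (m i)] {n : ℕ}
  {𝔸 : Type*} [NormedRing 𝔸] [StarRing 𝔸] [NormedAlgebra ℂ 𝔸] [StarModule ℂ 𝔸] [CompleteSpace 𝔸] [NormOneClass 𝔸]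
  {W : Type*} [NormedAddCommGroup W] [InnerProductSpace ℂ W] [FiniteDimensional ℂ W] (φ : W ≃ₗ[ℂ] 𝔸) {Mφ Mφ' : ℝ}
  (hφ : ∀ w, ‖φ w‖ ≤ Mφ * ‖w‖) (hφ' : ∀ X, ‖φ.symm X‖ ≤ Mφ' * ‖X‖) (hMφ : 0 ≤ Mφ) (hMφ' : 0 ≤ Mφ')
  {c₀ : ℝ} [Fact (0 < c₀)] {c₁ : ℝ} [Fact (0 < c₁)] {η : ℝ} (hη : 0 < η) (hηL : η * (L : ℝ) ^ (n + 1) = 1)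
  (U : Bond d (towerP L m (n + 1)) → 𝔸ˣ) (hU : ∀ b, U b ∈ U1 𝔸)
  (hRS : ∀ (b : Bond d (towerP L m (n + 1))) (v u : W), ⟪adTransportW φ U b v, u⟫_ℂ = ⟪v, adTransportW φ (fun b => (U b)⁻¹) b u⟫_ℂ)
  (τ : 𝔸 →ₗ[ℂ] ℂ) (hL : 1 ≤ L) (α : ℕ → ℝ) (hα1 : ∀ j, α j ≤ 1 / 64)
  (hU1 : ∀ (j : ℕ) (x : B7Prop1Explicit.Site d) (κ : Fin d), perCfg (towerP L m (j + 1)) (B9Eq315QTower.UlevOf L m (n + 1) U j) x κ ∈ U1 𝔸)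
  (hreg : ∀ (j : ℕ) (y : TSite d (towerP L m j)) (κ : Fin d) (r : Fin d → Fin L),
    ‖((Wcx L (perCfg (towerP L m (j + 1)) (B9Eq315QTower.UlevOf L m (n + 1) U j)) (cornerSite L y) κ (boxVec L r) : 𝔸ˣ) : 𝔸) - 1‖ ≤ α j)
  (a : ℝ)


include hφ hφ' hMφ hMφ' hη hηL hU hRS in
/-- **THE `L²` DECAY OF `H₁,k(U)` ON THE TOWER, EVERY HEIGHT `n`** (diagonal `ηL^{n+1} = 1`): for every background of the letters in the per-level regime `hαL`, given
the `γ`-coercivity of `Δ_{a,k}` (Thm 3.11), the lower bound `μ₁` of `Q_kG₁Q_k†` ([B11] (45)), the `Δ′` floor `p_K`, `‖Q_k‖ ≤ C_Q`, `C_P`, the radius windows, `small`,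
`small2`, the conjugated `Q_k(U)` ∕ `Δ′` ∕ `R_k(U)` letters uniformly over the fine weights, their companions and the circle `‖κ‖ = r`, and the `Q_k†` block-to-point
decay letter `C_Q†` — all DISPLAYED — for every `0 ≤ r′ < r`:
`‖P_{y₁} ∘ H₁,k(U) ∘ r_{y₀}‖ ≤ (4∕γ)e^{r}·C_Q†·(2∕μ₁)e^{r}·K_d(r − r′)²·e^{−r′·d_m(y₀,y₁)}`.
[cite: Balaban1985BackgroundPropagators, (3.26) p.395, (3.49) p.399, (3.126) p.420, Thm 3.11 p.416; Balaban1985Variational, (45) p.285, (103) p.293, (110) p.294] -/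
theorem norm_block_H1k_le (hαL : ∀ j, 50 * (d + 1) * α j * (L : ℝ) ^ d ≤ 1 / 2) (ha : 0 ≤ a) (hm : ∀ i, 1 ≤ m i)
    (hpos : ∀ x : BondL2K ℂ d (towerP L m (n + 1)) c₀ W, x ≠ 0 → 0 < RCLike.re ⟪x, laplaceAk L m n φ η U hL α hα1 hU1 hreg τ (c₀ := c₀) (c₁ := c₁) a x⟫_ℂ) (hQs : Function.Surjective (QkW L m n φ U hL α hα1 hU1 hreg (c₀ := c₀) (c₁ := c₁)))
    {γ β βK pK ℓ ℓ' r ρ CP CQ μ₁ : ℝ} (hγ : 0 < γ) (hγ1 : γ ≤ 1) (hβ : 0 ≤ β) (hβ1 : β ≤ 1) (hβK : 0 ≤ βK) (hℓ : 1 ≤ ℓ) (hℓ' : 1 ≤ ℓ') (hr : 0 ≤ r)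
    (hρ : 0 ≤ ρ) (hρ8 : ρ ≤ 1 / 8) (hCP : 0 ≤ CP) (hCQ : 0 ≤ CQ) (hμ₁ : 0 < μ₁)
    (hcoer : ∀ f : BondL2K ℂ d (towerP L m (n + 1)) c₀ W, γ * ‖f‖ ^ 2 ≤ RCLike.re ⟪f, laplaceAk L m n φ η U hL α hα1 hU1 hreg τ (c₀ := c₀) (c₁ := c₁) a f⟫_ℂ)
    (hX1 : ∀ g : BondL2K ℂ d m c₁ W, μ₁ * ‖g‖ ^ 2 ≤ RCLike.re ⟪g, (QkW L m n φ U hL α hα1 hU1 hreg (c₀ := c₀) (c₁ := c₁)) (G1k L m n φ η U hL α hα1 hU1 hreg τ (c₀ := c₀) (c₁ := c₁) hpos (LinearMap.adjoint (QkW L m n φ U hL α hα1 hU1 hreg (c₀ := c₀) (c₁ := c₁)) g))⟫_ℂ)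
    (hKre : ∀ f : BondL2K ℂ d (towerP L m (n + 1)) c₀ W, -(pK * ‖f‖ ^ 2) ≤ RCLike.re ⟪f, curvOp φ τ η U f⟫_ℂ)
    (hQ : ∀ f, ‖(QkW L m n φ U hL α hα1 hU1 hreg (c₀ := c₀) (c₁ := c₁)) f‖ ≤ CQ * ‖f‖)
    (hwin : r * ℓ * η ≤ 1)
    (hβCC : 4 * r * ℓ * (Mφ * Mφ') * (d * Real.sqrt d) ≤ β) (hβC : 4 * r * ℓ * (Mφ * Mφ') * d ≤ β)
    (hβD : 2 * r * ℓ * (Mφ * Mφ') * Real.sqrt d ≤ β)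
    (hQK : ∀ (χ : TSite d (towerP L m (n + 1)) → ℝ) (χ' : TSite d m → ℝ),
      (∀ b : Bond d (towerP L m (n + 1)), |χ (bpos b) - χ (btgt b)| ≤ ℓ * η) →
      (∀ (y : TSite d m) (x : TSite d (towerP L m (n + 1))),
        siteCast (towerP_eq_fineP_pow L m (n + 1)) x ∈ B9Eq319QprimeTorus.blockOf (L ^ (n + 1)) m y → |χ' y - χ x| ≤ ℓ') →
      ∀ (MB : BondL2K ℂ d (towerP L m (n + 1)) c₀ W →L[ℂ] BondL2K ℂ d (towerP L m (n + 1)) c₀ W),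
      (∀ (g : BondL2K ℂ d (towerP L m (n + 1)) c₀ W) (b : Bond d (towerP L m (n + 1))),
        WL2.equiv ℂ (fun _ : Bond d (towerP L m (n + 1)) => c₀) W (MB g) b = (χ (bpos b) : ℂ) • WL2.equiv ℂ (fun _ : Bond d (towerP L m (n + 1)) => c₀) W g b) →
      ∀ (MS : SiteL2K ℂ d (towerP L m (n + 1)) c₀ W →L[ℂ] SiteL2K ℂ d (towerP L m (n + 1)) c₀ W),
      (∀ (g : SiteL2K ℂ d (towerP L m (n + 1)) c₀ W) (x : TSite d (towerP L m (n + 1))),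
        WL2.equiv ℂ (fun _ : TSite d (towerP L m (n + 1)) => c₀) W (MS g) x = (χ x : ℂ) • WL2.equiv ℂ (fun _ : TSite d (towerP L m (n + 1)) => c₀) W g x) →
      ∀ (MF : BondL2K ℂ d m c₁ W →L[ℂ] BondL2K ℂ d m c₁ W),
      (∀ (g : BondL2K ℂ d m c₁ W) (b' : Bond d m),
        WL2.equiv ℂ (fun _ : Bond d m => c₁) W (MF g) b' = (χ' (bpos b') : ℂ) • WL2.equiv ℂ (fun _ : Bond d m => c₁) W g b') →
      ∀ κ : ℂ, ‖κ‖ = r →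
      (∀ f, ‖exp (κ • MF) ((QkW L m n φ U hL α hα1 hU1 hreg (c₀ := c₀) (c₁ := c₁)) (exp (κ • (-MB)) f)) - (QkW L m n φ U hL α hα1 hU1 hreg (c₀ := c₀) (c₁ := c₁)) f‖ ≤ β * ‖f‖) ∧
      (∀ g, ‖exp (κ • MB) (LinearMap.adjoint (QkW L m n φ U hL α hα1 hU1 hreg (c₀ := c₀) (c₁ := c₁)) (exp (κ • (-MF)) g)) - LinearMap.adjoint (QkW L m n φ U hL α hα1 hU1 hreg (c₀ := c₀) (c₁ := c₁)) g‖ ≤ β * ‖g‖) ∧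
      (∀ f, ‖exp (κ • MB) (curvOp φ τ η U (exp (κ • (-MB)) f)) - curvOp φ τ η U f‖ ≤ βK * ‖f‖) ∧
      (∀ s, ‖exp (κ • MS) (RofUk L m n φ η U (c₀ := c₀) (exp (κ • (-MS)) s)) - RofUk L m n φ η U (c₀ := c₀) s‖ ≤ ρ * ‖s‖))
    (hP : ∀ f, ‖covDivL2K ℂ c₀ ((η : ℂ))⁻¹ (adTransportW φ fun b => (U b)⁻¹) f -
      RofUk L m n φ η U (c₀ := c₀) (covDivL2K ℂ c₀ ((η : ℂ))⁻¹ (adTransportW φ fun b => (U b)⁻¹) f)‖ ≤ CP * ‖f‖)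
    (small : pK / 2 + (21 + 3 * a) * β ^ 2 + 4 * β * CP + 2 * ρ * CP ^ 2 + βK ≤ γ / 4)
    (small2 : β * (4 / γ) * (2 * CQ + 1) + CQ * (CQ + 1) *
        (β * (4 / γ * (2 * (8 / γ) + (8 / γ + 4 / γ) + 2 * ((8 / γ + 4 / γ * CP) + 4 / γ) + a * CQ * (4 / γ) + a * (CQ + 1) * (4 / γ))) +
          ρ * ((8 / γ + 4 / γ * CP) * ((8 / γ + 4 / γ * CP) + 4 / γ)) + βK * (4 / γ) ^ 2) ≤ μ₁ / 2)
    (PB : TSite d m → BondL2K ℂ d (towerP L m (n + 1)) c₀ W →L[ℂ] BondL2K ℂ d (towerP L m (n + 1)) c₀ W)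
    (hPB : ∀ (y : TSite d m) (f : BondL2K ℂ d (towerP L m (n + 1)) c₀ W) (b : Bond d (towerP L m (n + 1))),
      WL2.equiv ℂ (fun _ : Bond d (towerP L m (n + 1)) => c₀) W (PB y f) b =
        if blockCoord (L ^ (n + 1)) m (siteCast (towerP_eq_fineP_pow L m (n + 1)) (bpos b)) = y then
          WL2.equiv ℂ (fun _ : Bond d (towerP L m (n + 1)) => c₀) W f b else 0)
    {rF : TSite d m → BondL2K ℂ d m c₁ W →L[ℂ] BondL2K ℂ d m c₁ W}
    (hrF : ∀ (y : TSite d m) (g : BondL2K ℂ d m c₁ W) (b' : Bond d m),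
      WL2.equiv ℂ (fun _ : Bond d m => c₁) W (rF y g) b' = if bpos b' = y then WL2.equiv ℂ (fun _ : Bond d m => c₁) W g b' else 0)
    {CQa r' : ℝ} (hCQa : 0 ≤ CQa) (hr' : 0 ≤ r') (hr'r : r' < r)
    (hQa : ∀ z z', ‖PB z' ∘L LinearMap.toContinuousLinearMap (LinearMap.adjoint (QkW L m n φ U hL α hα1 hU1 hreg (c₀ := c₀) (c₁ := c₁))) ∘L rF z‖ ≤
      CQa * Real.exp (-(r * tdist m z z')))
    (y₀ y₁ : TSite d m) :
    ‖PB y₁ ∘L LinearMap.toContinuousLinearMap (H1k L m n φ η U hL α hα1 hU1 hreg τ hαL hpos) ∘L rF y₀‖ ≤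
      (4 / γ * Real.exp r) * CQa * (2 / μ₁ * Real.exp r) * latticeConst d (r - r') ^ 2 * Real.exp (-(r' * tdist m y₀ y₁)) :=
  norm_block_H1k_le_of_letters φ η U τ hL α hα1 hU1 hreg hαL hpos hQs hPB hrF hm (by positivity) hCQa (by positivity) hr' hr'r
    (fun z y => norm_block_G1k_le φ hφ hφ' hMφ hMφ' hη hηL U hU hRS τ hL α hα1 hU1 hreg a ha hm hpos hγ hβ hℓ hℓ' hr hρ hρ8 hCP hcoer hKre hwin hβCC hβC
      hβD hQK hP small PB hPB z y)
    hQa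
    (fun y z => norm_bondPoint_Kinv_le φ hφ hφ' hMφ hMφ' hη hηL U hU hRS τ hL α hα1 hU1 hreg a ha hm hpos hQs hγ hγ1 hβ hβ1 hβK hℓ hℓ' hr hρ hρ8 hCP hCQ hμ₁
      hcoer hX1 hKre hQ hwin hβCC hβC hβD hQK hP small small2 hrF y z)
    y₀ y₁

end Literature.MathematicalPhysics.QuantumFieldTheory.Balaban1983to89.B9Eq3126H1BlockDecayTower

end
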